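import Literature.Analysis.FluidPDE.PineauVicolOneSlicePressure
import Literature.Analysis.FluidPDE.PineauVicolOneSliceHigherGradient
import Literature.Analysis.FluidPDE.PineauVicolOneSliceCompactness
import Literature.Analysis.FluidPDE.HarmonicProbe
import Literature.Analysis.FluidPDE.LeraySelfSimilarCalculus
import Literature.Analysis.FluidPDE.PineauVicolRSSAlphaZero
import Literature.Analysis.FluidPDE.TaoEnstrophyLocalisation
import Literature.Analysis.FluidPDE.PineauVicolEnstrophyIdentity
import HarnessLib

/-!
# Pineau–Vicol (2026), Theorem 1.9 — one-slice smallness of the vorticity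

The input (S4) of the reduction `pineauVicol2026_oneSlice_regularity_of_core`
(file `PineauVicolOneSliceReduction`) of the one-slice regularity criterion
`pineauVicol2026_oneSlice_regularity` [PineauVicol2026, Theorem 1.9]: for a Type I classical
solution on `[-1,0) × B₁` with bounded pressure on the annulus `{½ < |x| < ¾}`, a slice `t = t̄`
close to `0` which is `δ₀`-close to self-similar in the sense of (1.17) has small vorticity at the
comparable scales, `∫_{B(0,2R√(−t̄))} |ω(t̄)|² ≤ θ²/(4√(−t̄))`
(`pineauVicol_oneSlice_vorticity_small`).

Pineau–Vicol obtain this (their (9.23)) from the weighted energy identity (9.20)–(9.22) built on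
the principal Dirichlet eigenfunction of the adjoint linearised operator (§5, Lemmas 5.3–5.4).
Here the same statement is proved by **compactness and Tsai's Liouville theorem**, both
available in the tree: if the bound failed along a sequence with `δₙ → 0`, the cut-off similarity
profiles `Fₙ(y) = cₙ (χuₙ(t̄ₙ))(cₙy)`, `cₙ = √(−t̄ₙ)`, would be bounded in `C³_loc` by the
quantitative Serrin bounds of `PineauVicolOneSliceHigherGradient`, would satisfy the Leray
profile system up to an error `≤ δₙ` (this is exactly the quantity (1.17)), be divergence free,
obey `|Fₙ(y)| ≤ C_u/(1+|y|)` and have `∫_{B_{2R}} |curl Fₙ|² > θ²/4`; a `C²_loc` limit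
(`PineauVicolOneSliceCompactness`) is a Leray profile `IsLerayProfile 1 ½ G P` in `L⁴(ℝ³)`
(`memLp_four_of_profile_bound`), hence `G = 0` by `tsai_selfsimilar_holds` [Tsai1998, Thm 1],
contradicting the lower bound on `∫_{B_{2R}} |curl G|²`.

Contents: the algebra of the similarity profile of a slice (`curl_const_smul_comp_smul`,
`profile_eq_at_slice`), the cut-off profile (`norm_iteratedFDeriv_cutoffProfile_le`,
`cutoffProfile_eq`, `lintegral_ball_curl_cutoffProfile`, `divergence_cutoffProfile_eq_zero`),
and the theorem `pineauVicol_oneSlice_vorticity_small`. No new facts are introduced.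

## References

* B. Pineau, V. Vicol, *On rotated backwards self-similar solutions of the incompressible 3D
  Navier–Stokes equations*, arXiv:2607.09619 (2026), Theorem 1.9, (1.17)–(1.18), §9.3
  (9.20)–(9.23), pp. 8, 52–53. [PineauVicol2026]
* T.-P. Tsai, *On Leray's self-similar solutions of the Navier–Stokes equations satisfying local
  energy estimates*, Arch. Rational Mech. Anal. 143 (1998) 29–51, Theorem 1. [Tsai1998]
-/

noncomputable section

open MeasureTheory Set Function Filter Metric TopologicalSpace InnerProductSpace
open _root_.Topology
open scoped ENNReal NNReal InnerProductSpace RealInnerProductSpace Laplacian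

namespace Literature.Analysis.FluidPDE

section ProfileAlgebra

-- nested operator types
set_option maxSynthPendingDepth 3

variable {u : ℝ → EuclideanSpace ℝ (Fin 3) → EuclideanSpace ℝ (Fin 3)}
  {p : ℝ → EuclideanSpace ℝ (Fin 3) → ℝ}

/-- `∇(c² p(c ·))(y) = c³ • (∇p)(c y)` (no differentiability needed). [folklore] -/
theorem gradient_sq_mul_comp_smul (q : EuclideanSpace ℝ (Fin 3) → ℝ) (c : ℝ)
    (y : EuclideanSpace ℝ (Fin 3)) :
    gradient (fun z => c ^ 2 * q (c • z)) y = c ^ 3 • gradient q (c • y) := by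
  have h1 : (fun z : EuclideanSpace ℝ (Fin 3) => c ^ 2 * q (c • z)) = fun z => c ^ 2 • q (c • z) := by
    funext z; rfl
  have h2 : fderiv ℝ (fun z : EuclideanSpace ℝ (Fin 3) => c ^ 2 • q (c • z)) y =
      (c ^ 2 * c) • fderiv ℝ q (c • y) := fderiv_const_smul_comp_smul' q (c ^ 2) c y
  have h3 : gradient (fun z : EuclideanSpace ℝ (Fin 3) => c ^ 2 * q (c • z)) y =
      (InnerProductSpace.toDual ℝ (EuclideanSpace ℝ (Fin 3))).symm
        (fderiv ℝ (fun z : EuclideanSpace ℝ (Fin 3) => c ^ 2 • q (c • z)) y) := by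
    rw [h1]; rfl
  rw [h3, h2, LinearIsometryEquiv.map_smul, show c ^ 2 * c = c ^ 3 by ring]
  rfl

/-- **The profile equation at one time, with the (1.17) defect as error.** For a classical
solution of Navier–Stokes (`ν = 1`, `f = 0`) on `[−1,0) × B₁` and `−1 < t̄ < 0`, the profile
`U(y) = c u(t̄, c y)`, `Q(y) = c² p(t̄, c y)`, `c = √(−t̄)`, satisfies, for `|c y| < 1`,
`−ΔU + ½U + ½(y·∇)U + (U·∇)U + ∇Q = −c • ((−t̄)∂ₜu − ½u − ½(x·∇)u)(t̄, c y)` — Leray's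
steady profile system (`IsLerayProfile 1 ½`) up to the self-similar time derivative (1.18),
whose size is exactly what (1.17) controls (the momentum equation at `(t̄, c y)` and the
dilation rules `DU(y) = c²Du(cy)`, `ΔU(y) = c³Δu(cy)`, `∇Q(y) = c³∇p(cy)`).
[cite: PineauVicol2026, (1.17)–(1.18) and (9.2), arXiv:2607.09619 p. 8 and p. 30] -/
theorem profile_eq_at_slice
    (hreg : IsClassicalNSSolutionOnRegion
      (Ico (-1 : ℝ) 0 ×ˢ ball (0 : EuclideanSpace ℝ (Fin 3)) 1) 1 0 u p)
    {tb : ℝ} (ht1 : -1 < tb) (ht0 : tb < 0) {y : EuclideanSpace ℝ (Fin 3)}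
    (hy : Real.sqrt (-tb) • y ∈ ball (0 : EuclideanSpace ℝ (Fin 3)) 1) :
    -((Δ fun z => Real.sqrt (-tb) • u tb (Real.sqrt (-tb) • z)) y) +
        (1 / 2 : ℝ) • (Real.sqrt (-tb) • u tb (Real.sqrt (-tb) • y)) +
        (1 / 2 : ℝ) • fderiv ℝ (fun z => Real.sqrt (-tb) • u tb (Real.sqrt (-tb) • z)) y y +
        convect (fun z => Real.sqrt (-tb) • u tb (Real.sqrt (-tb) • z))
          (fun z => Real.sqrt (-tb) • u tb (Real.sqrt (-tb) • z)) y +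
        gradient (fun z => Real.sqrt (-tb) ^ 2 * p tb (Real.sqrt (-tb) • z)) y =
      -(Real.sqrt (-tb) •
        ((-tb) • timeDerivOn (Ico (-1 : ℝ) 0 ×ˢ ball (0 : EuclideanSpace ℝ (Fin 3)) 1) u tb
            (Real.sqrt (-tb) • y)
          - (1 / 2 : ℝ) • u tb (Real.sqrt (-tb) • y)
          - (1 / 2 : ℝ) • fderiv ℝ (u tb) (Real.sqrt (-tb) • y) (Real.sqrt (-tb) • y))) := by
  set c : ℝ := Real.sqrt (-tb) with hc_def
  have hc : 0 < c := Real.sqrt_pos.2 (by linarith)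
  have hc2 : c ^ 2 = -tb := Real.sq_sqrt (by linarith)
  set x : EuclideanSpace ℝ (Fin 3) := c • y with hx_def
  -- the momentum equation at `(t̄, x)`
  have hmom := hreg.momentum tb x (mk_mem_prod ⟨ht1.le, ht0⟩ hy)
  simp only [one_smul, Pi.zero_apply, add_zero] at hmom
  -- dilation rules
  have hD : fderiv ℝ (fun z => c • u tb (c • z)) y = c ^ 2 • fderiv ℝ (u tb) x :=
    fderiv_smul_comp_smul (u tb) c y
  have hΔ : (Δ fun z => c • u tb (c • z)) y = c ^ 3 • (Δ (u tb)) x := by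
    rw [laplacian_const_smul_comp_smul (u tb) c hc.ne' y, show c * c ^ 2 = c ^ 3 by ring]
  have hG : gradient (fun z => c ^ 2 * p tb (c • z)) y = c ^ 3 • gradient (p tb) x :=
    gradient_sq_mul_comp_smul (p tb) c y
  have hconv : convect (fun z => c • u tb (c • z)) (fun z => c • u tb (c • z)) y =
      c ^ 3 • convect (u tb) (u tb) x := by
    simp only [convect, hD, FunLike.coe_smul, Pi.smul_apply, ContinuousLinearMap.map_smul,
      smul_smul]
    ring_nf
    rfl
  rw [hΔ, hD, hG, hconv]
  -- `∂ₜu = Δu − (u·∇)u − ∇p` at `(t̄, x)`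
  have hdt : timeDerivOn (Ico (-1 : ℝ) 0 ×ˢ ball (0 : EuclideanSpace ℝ (Fin 3)) 1) u tb x =
      (Δ (u tb)) x - gradient (p tb) x - convect (u tb) (u tb) x := by
    rw [← hmom]; abel
  rw [hdt, ← hc2, FunLike.coe_smul, Pi.smul_apply, ContinuousLinearMap.map_smul]
  simp only [smul_sub, smul_smul]
  module

end ProfileAlgebra

section CutoffProfile

-- nested operator types
set_option maxSynthPendingDepth 3

variable {u : ℝ → EuclideanSpace ℝ (Fin 3) → EuclideanSpace ℝ (Fin 3)}
  {p : ℝ → EuclideanSpace ℝ (Fin 3) → ℝ} {χ : EuclideanSpace ℝ (Fin 3) → ℝ}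

/-- The cut-off profile `F(z) = c (χ u(t̄))(c z)` agrees near `y` with the raw profile
`c u(t̄, c ·)` as soon as `χ ≡ 1` near `c y`. [folklore] -/
theorem cutoffProfile_eventuallyEq {y : EuclideanSpace ℝ (Fin 3)} {c : ℝ} (hχ1 : ∀ᶠ x in 𝓝 (c • y), χ x = 1) (t : ℝ) :
    (fun z : EuclideanSpace ℝ (Fin 3) => c • (χ (c • z) • u t (c • z))) =ᶠ[𝓝 y]
      fun z => c • u t (c • z) := by
  have hcont : Continuous fun z : EuclideanSpace ℝ (Fin 3) => c • z := continuous_const_smul c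
  have h : ∀ᶠ z in 𝓝 y, χ (c • z) = 1 := hcont.continuousAt.eventually hχ1
  filter_upwards [h] with z hz
  rw [hz]
  simp

/-- The same for the cut-off pressure profile `c² (χ p(t̄))(c ·)`. [folklore] -/
theorem cutoffPressure_eventuallyEq {y : EuclideanSpace ℝ (Fin 3)} {c : ℝ} (hχ1 : ∀ᶠ x in 𝓝 (c • y), χ x = 1) (t : ℝ) :
    (fun z : EuclideanSpace ℝ (Fin 3) => c ^ 2 * (χ (c • z) * p t (c • z))) =ᶠ[𝓝 y]
      fun z => c ^ 2 * p t (c • z) := by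
  have hcont : Continuous fun z : EuclideanSpace ℝ (Fin 3) => c • z := continuous_const_smul c
  have h : ∀ᶠ z in 𝓝 y, χ (c • z) = 1 := hcont.continuousAt.eventually hχ1
  filter_upwards [h] with z hz
  rw [hz]
  simp

/-- **Uniform bounds for the derivatives of the cut-off profile** at the points where the
Type I derivative bound of order `k` is available: with `c = √(−t̄)`, `χ ≡ 1` near `c y`,
`supp χ ⊆ B₁` and `c(1 + |y|) ≤ c₁`,
`‖Dᵏ(c (χu(t̄))(c ·))(y)‖ ≤ K (1 + |y|)⁻ᵏ⁻¹` (the dilation rule for `Dᵏ` through the globally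
smooth `χ u(t̄)`, and `|x| + √(−t̄) = c(1 + |y|)` at `x = c y`). [cite: PineauVicol2026, Cor. 9.3 (9.4), arXiv:2607.09619 p. 30] -/
theorem norm_iteratedFDeriv_cutoffProfile_le {k : ℕ} {K c₁ : ℝ}
    (Hk : ∀ t ∈ Ioo (-1 : ℝ) 0, ∀ x : EuclideanSpace ℝ (Fin 3), ‖x‖ + Real.sqrt (-t) ≤ c₁ →
      ‖iteratedFDeriv ℝ k (u t) x‖ ≤ K / (‖x‖ + Real.sqrt (-t)) ^ (k + 1))
    (hreg : IsClassicalNSSolutionOnRegion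
      (Ico (-1 : ℝ) 0 ×ˢ ball (0 : EuclideanSpace ℝ (Fin 3)) 1) 1 0 u p)
    (hχ : ContDiff ℝ (⊤ : ℕ∞) χ) (hχs : tsupport χ ⊆ ball (0 : EuclideanSpace ℝ (Fin 3)) 1)
    {tb : ℝ} (ht : tb ∈ Ioo (-1 : ℝ) 0) {y : EuclideanSpace ℝ (Fin 3)}
    (hχ1 : ∀ᶠ x in 𝓝 (Real.sqrt (-tb) • y), χ x = 1)
    (hsmall : Real.sqrt (-tb) * (1 + ‖y‖) ≤ c₁) :
    ‖iteratedFDeriv ℝ k (fun z => Real.sqrt (-tb) • (χ (Real.sqrt (-tb) • z) • u tb (Real.sqrt (-tb) • z))) y‖ ≤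
      K / (1 + ‖y‖) ^ (k + 1) := by
  set c : ℝ := Real.sqrt (-tb) with hc_def
  have hc : 0 < c := Real.sqrt_pos.2 (by linarith [ht.2])
  -- the globally smooth cut-off slice
  have hsec : spaceSection (Ico (-1 : ℝ) 0 ×ˢ ball (0 : EuclideanSpace ℝ (Fin 3)) 1) tb = ball 0 1 :=
    spaceSection_prod (Ioo_subset_Ico_self ht) _
  have hu : ContDiffOn ℝ (⊤ : ℕ∞) (u tb) (ball (0 : EuclideanSpace ℝ (Fin 3)) 1) := by
    have := hreg.contDiffOn_velocity tb
    rw [hsec] at this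
    exact this
  set H : EuclideanSpace ℝ (Fin 3) → EuclideanSpace ℝ (Fin 3) := fun x => χ x • u tb x with hH
  have hHs : ContDiff ℝ (⊤ : ℕ∞) H := contDiff_cutoff_smul_of_contDiffOn isOpen_ball hχ hχs hu
  have e : (fun z => c • (χ (c • z) • u tb (c • z))) = fun z => c • H (c • (z - 0)) := by
    funext z; simp [hH]
  rw [e]
  refine (norm_iteratedFDeriv_smul_comp_smul_sub_le hHs c c 0 y k).trans ?_
  rw [sub_zero, abs_of_pos hc]
  -- `Dᵏ H (c y) = Dᵏ u(t̄) (c y)`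
  have hHu : H =ᶠ[𝓝 (c • y)] u tb := by
    filter_upwards [hχ1] with x hx
    simp [hH, hx]
  rw [(hHu.iteratedFDeriv ℝ k).eq_of_nhds]
  have hb := Hk tb ht (c • y) (by rw [norm_smul, Real.norm_of_nonneg hc.le]; linarith)
  rw [norm_smul, Real.norm_of_nonneg hc.le, show c * ‖y‖ + c = c * (1 + ‖y‖) by ring,
    mul_pow] at hb
  have hpos : 0 < (1 + ‖y‖) ^ (k + 1) := by positivity
  have hck : 0 < c ^ (k + 1) := by positivity
  calc c * c ^ k * ‖iteratedFDeriv ℝ k (u tb) (c • y)‖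
      ≤ c * c ^ k * (K / (c ^ (k + 1) * (1 + ‖y‖) ^ (k + 1))) := by gcongr
    _ = K / (1 + ‖y‖) ^ (k + 1) := by
        rw [show c * c ^ k = c ^ (k + 1) by ring]
        field_simp

/-- **The profile equation of the cut-off profile**, at the points where `χ ≡ 1` near `c y`
(`profile_eq_at_slice` transported along the local agreement). [cite: PineauVicol2026, (1.17)–(1.18), arXiv:2607.09619 p. 8] -/
theorem cutoffProfile_eq
    (hreg : IsClassicalNSSolutionOnRegion
      (Ico (-1 : ℝ) 0 ×ˢ ball (0 : EuclideanSpace ℝ (Fin 3)) 1) 1 0 u p)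
    {tb : ℝ} (ht1 : -1 < tb) (ht0 : tb < 0) {y : EuclideanSpace ℝ (Fin 3)}
    (hy : Real.sqrt (-tb) • y ∈ ball (0 : EuclideanSpace ℝ (Fin 3)) 1)
    (hχ1 : ∀ᶠ x in 𝓝 (Real.sqrt (-tb) • y), χ x = 1) :
    -((Δ fun z => Real.sqrt (-tb) • (χ (Real.sqrt (-tb) • z) • u tb (Real.sqrt (-tb) • z))) y) +
        (1 / 2 : ℝ) • (Real.sqrt (-tb) • (χ (Real.sqrt (-tb) • y) • u tb (Real.sqrt (-tb) • y))) +
        (1 / 2 : ℝ) • fderiv ℝ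
          (fun z => Real.sqrt (-tb) • (χ (Real.sqrt (-tb) • z) • u tb (Real.sqrt (-tb) • z))) y y +
        convect (fun z => Real.sqrt (-tb) • (χ (Real.sqrt (-tb) • z) • u tb (Real.sqrt (-tb) • z)))
          (fun z => Real.sqrt (-tb) • (χ (Real.sqrt (-tb) • z) • u tb (Real.sqrt (-tb) • z))) y +
        gradient (fun z => Real.sqrt (-tb) ^ 2 * (χ (Real.sqrt (-tb) • z) * p tb (Real.sqrt (-tb) • z))) y =
      -(Real.sqrt (-tb) •
        ((-tb) • timeDerivOn (Ico (-1 : ℝ) 0 ×ˢ ball (0 : EuclideanSpace ℝ (Fin 3)) 1) u tb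
            (Real.sqrt (-tb) • y)
          - (1 / 2 : ℝ) • u tb (Real.sqrt (-tb) • y)
          - (1 / 2 : ℝ) • fderiv ℝ (u tb) (Real.sqrt (-tb) • y) (Real.sqrt (-tb) • y))) := by
  set c : ℝ := Real.sqrt (-tb) with hc_def
  have hF := cutoffProfile_eventuallyEq (u := u) hχ1 tb
  have hQ := cutoffPressure_eventuallyEq (p := p) hχ1 tb
  have h0 : χ (c • y) = 1 := hχ1.self_of_nhds
  have e1 : (Δ fun z => c • (χ (c • z) • u tb (c • z))) y = (Δ fun z => c • u tb (c • z)) y :=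
    (InnerProductSpace.laplacian_congr_nhds hF).eq_of_nhds
  have e2 : fderiv ℝ (fun z => c • (χ (c • z) • u tb (c • z))) y = fderiv ℝ (fun z => c • u tb (c • z)) y :=
    hF.fderiv_eq
  have e3 : convect (fun z => c • (χ (c • z) • u tb (c • z)))
      (fun z => c • (χ (c • z) • u tb (c • z))) y =
      convect (fun z => c • u tb (c • z)) (fun z => c • u tb (c • z)) y := by
    simp only [convect, e2, h0, one_smul]
  have e4 : gradient (fun z => c ^ 2 * (χ (c • z) * p tb (c • z))) y =
      gradient (fun z => c ^ 2 * p tb (c • z)) y := by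
    show (InnerProductSpace.toDual ℝ (EuclideanSpace ℝ (Fin 3))).symm
        (fderiv ℝ (fun z => c ^ 2 * (χ (c • z) * p tb (c • z))) y) =
      (InnerProductSpace.toDual ℝ (EuclideanSpace ℝ (Fin 3))).symm (fderiv ℝ (fun z => c ^ 2 * p tb (c • z)) y)
    rw [hQ.fderiv_eq]
  rw [e1, e2, e3, e4, h0, one_smul]
  exact profile_eq_at_slice hreg ht1 ht0 hy

/-- `curl v x` depends only on `Dv(x)`. [folklore] -/
theorem curl_congr_fderiv {v w : EuclideanSpace ℝ (Fin 3) → EuclideanSpace ℝ (Fin 3)}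
    {x : EuclideanSpace ℝ (Fin 3)} (h : fderiv ℝ v x = fderiv ℝ w x) : curl v x = curl w x := by
  unfold curl
  rw [h]

/-- **The vorticity of the cut-off profile on `B(0, 2R)`**, `2Rc ≤ ½`:
`∫_{B_{2R}} |curl F|² dy = c ∫_{B(2Rc)} |curl u(t̄)|² dx` (`curl F(y) = c² curl u(t̄, cy)` there,
and the substitution `x = c y`). [folklore] -/
theorem lintegral_ball_curl_cutoffProfile
    (hχ1 : ∀ x ∈ ball (0 : EuclideanSpace ℝ (Fin 3)) (1 / 2), ∀ᶠ z in 𝓝 x, χ z = 1)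
    {tb : ℝ} (ht0 : tb < 0) {R : ℝ} (hR : 0 < R) (hRc : 2 * R * Real.sqrt (-tb) ≤ 1 / 2) :
    ∫⁻ y in ball (0 : EuclideanSpace ℝ (Fin 3)) (2 * R),
        ENNReal.ofReal (‖curl (fun z => Real.sqrt (-tb) • (χ (Real.sqrt (-tb) • z) • u tb (Real.sqrt (-tb) • z))) y‖ ^ 2) =
      ENNReal.ofReal (Real.sqrt (-tb)) *
        ∫⁻ x in ball (0 : EuclideanSpace ℝ (Fin 3)) (2 * R * Real.sqrt (-tb)),
          ENNReal.ofReal (‖curl (u tb) x‖ ^ 2) := by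
  set c : ℝ := Real.sqrt (-tb) with hc_def
  have hc : 0 < c := Real.sqrt_pos.2 (by linarith)
  -- pointwise on the ball
  have hpt : ∀ y ∈ ball (0 : EuclideanSpace ℝ (Fin 3)) (2 * R),
      ENNReal.ofReal (‖curl (fun z => c • (χ (c • z) • u tb (c • z))) y‖ ^ 2) =
        ENNReal.ofReal (c ^ 4) * ENNReal.ofReal (‖curl (u tb) (c • y)‖ ^ 2) := by
    intro y hy
    have hcy : c • y ∈ ball (0 : EuclideanSpace ℝ (Fin 3)) (1 / 2) := by
      rw [mem_ball_zero_iff, norm_smul, Real.norm_of_nonneg hc.le]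
      rw [mem_ball_zero_iff] at hy
      have h1 : c * ‖y‖ < c * (2 * R) := by gcongr
      calc c * ‖y‖ < c * (2 * R) := h1
        _ = 2 * R * c := by ring
        _ ≤ 1 / 2 := hRc
    have hF := cutoffProfile_eventuallyEq (u := u) (hχ1 _ hcy) tb
    have hc4 : (0 : ℝ) ≤ c ^ 4 := by positivity
    rw [curl_congr_fderiv hF.fderiv_eq, curl_const_smul_comp_smul, norm_smul, mul_pow,
      Real.norm_of_nonneg (sq_nonneg c), ← ENNReal.ofReal_mul hc4]
    congr 1
    ring
  rw [setLIntegral_congr_fun measurableSet_ball hpt, lintegral_const_mul' _ _ ENNReal.ofReal_ne_top]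
  -- substitution `x = c y`
  have hsub := setLIntegral_preimage_comp_space_affine hc (0 : EuclideanSpace ℝ (Fin 3))
    (fun x => ENNReal.ofReal (‖curl (u tb) x‖ ^ 2)) (ball (0 : EuclideanSpace ℝ (Fin 3)) (2 * R * c))
  rw [space_affine_preimage_ball hc, sub_zero, smul_zero, show 2 * R * c / c = 2 * R by field_simp,
    finrank_euclideanSpace_fin] at hsub
  simp only [zero_add] at hsub
  rw [hsub, ← mul_assoc, ← ENNReal.ofReal_mul (by positivity)]
  congr 2
  field_simp

/-- **The cut-off profile is divergence free** where `χ ≡ 1` near `c y` and `c y ∈ B₁`: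
`div F(y) = c² div u(t̄, cy) = 0`. [folklore] -/
theorem divergence_cutoffProfile_eq_zero
    (hreg : IsClassicalNSSolutionOnRegion
      (Ico (-1 : ℝ) 0 ×ˢ ball (0 : EuclideanSpace ℝ (Fin 3)) 1) 1 0 u p)
    {tb : ℝ} (ht1 : -1 < tb) (ht0 : tb < 0) {y : EuclideanSpace ℝ (Fin 3)}
    (hy : Real.sqrt (-tb) • y ∈ ball (0 : EuclideanSpace ℝ (Fin 3)) 1)
    (hχ1 : ∀ᶠ x in 𝓝 (Real.sqrt (-tb) • y), χ x = 1) :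
    VectorCalculus.divergence
      (fun z => Real.sqrt (-tb) • (χ (Real.sqrt (-tb) • z) • u tb (Real.sqrt (-tb) • z))) y = 0 := by
  set c : ℝ := Real.sqrt (-tb) with hc_def
  have hF := cutoffProfile_eventuallyEq (u := u) hχ1 tb
  unfold VectorCalculus.divergence
  rw [hF.fderiv_eq, fderiv_smul_comp_smul (u tb) c y, ContinuousLinearMap.toLinearMap_smul, map_smul]
  have h0 := hreg.divFree tb (c • y) (mk_mem_prod ⟨ht1.le, ht0⟩ hy)
  unfold VectorCalculus.divergence at h0
  rw [h0, smul_zero]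

end CutoffProfile

section CutoffWrappers

variable {u : ℝ → EuclideanSpace ℝ (Fin 3) → EuclideanSpace ℝ (Fin 3)}
  {p : ℝ → EuclideanSpace ℝ (Fin 3) → ℝ} {χ : EuclideanSpace ℝ (Fin 3) → ℝ}

/-- `norm_iteratedFDeriv_cutoffProfile_le` with named scale `c = √(−t̄)` and profile `F`. [folklore] -/
theorem norm_iteratedFDeriv_cutoffProfile_le' {k : ℕ} {K c₁ : ℝ}
    (Hk : ∀ t ∈ Ioo (-1 : ℝ) 0, ∀ x : EuclideanSpace ℝ (Fin 3), ‖x‖ + Real.sqrt (-t) ≤ c₁ →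
      ‖iteratedFDeriv ℝ k (u t) x‖ ≤ K / (‖x‖ + Real.sqrt (-t)) ^ (k + 1))
    (hreg : IsClassicalNSSolutionOnRegion
      (Ico (-1 : ℝ) 0 ×ˢ ball (0 : EuclideanSpace ℝ (Fin 3)) 1) 1 0 u p)
    (hχ : ContDiff ℝ (⊤ : ℕ∞) χ) (hχs : tsupport χ ⊆ ball (0 : EuclideanSpace ℝ (Fin 3)) 1)
    {tb : ℝ} (ht : tb ∈ Ioo (-1 : ℝ) 0) {c : ℝ} (hc : c = Real.sqrt (-tb))
    {F : EuclideanSpace ℝ (Fin 3) → EuclideanSpace ℝ (Fin 3)}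
    (hF : F = fun z => c • (χ (c • z) • u tb (c • z)))
    {y : EuclideanSpace ℝ (Fin 3)} (hχ1 : ∀ᶠ x in 𝓝 (c • y), χ x = 1)
    (hsmall : c * (1 + ‖y‖) ≤ c₁) :
    ‖iteratedFDeriv ℝ k F y‖ ≤ K / (1 + ‖y‖) ^ (k + 1) := by
  subst hF hc
  exact norm_iteratedFDeriv_cutoffProfile_le Hk hreg hχ hχs ht hχ1 hsmall

/-- `cutoffProfile_eq` with named scale, profile and pressure profile. [folklore] -/
theorem cutoffProfile_eq'
    (hreg : IsClassicalNSSolutionOnRegion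
      (Ico (-1 : ℝ) 0 ×ˢ ball (0 : EuclideanSpace ℝ (Fin 3)) 1) 1 0 u p)
    {tb : ℝ} (ht1 : -1 < tb) (ht0 : tb < 0) {c : ℝ} (hc : c = Real.sqrt (-tb))
    {F : EuclideanSpace ℝ (Fin 3) → EuclideanSpace ℝ (Fin 3)}
    (hF : F = fun z => c • (χ (c • z) • u tb (c • z)))
    {Q : EuclideanSpace ℝ (Fin 3) → ℝ} (hQ : Q = fun z => c ^ 2 * (χ (c • z) * p tb (c • z)))
    {y : EuclideanSpace ℝ (Fin 3)} (hy : c • y ∈ ball (0 : EuclideanSpace ℝ (Fin 3)) 1)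
    (hχ1 : ∀ᶠ x in 𝓝 (c • y), χ x = 1) :
    -((Δ F) y) + (1 / 2 : ℝ) • F y + (1 / 2 : ℝ) • fderiv ℝ F y y + convect F F y + gradient Q y =
      -(c • ((-tb) • timeDerivOn (Ico (-1 : ℝ) 0 ×ˢ ball (0 : EuclideanSpace ℝ (Fin 3)) 1) u tb (c • y)
          - (1 / 2 : ℝ) • u tb (c • y) - (1 / 2 : ℝ) • fderiv ℝ (u tb) (c • y) (c • y))) := by
  subst hF hQ hc
  exact cutoffProfile_eq hreg ht1 ht0 hy hχ1

/-- `lintegral_ball_curl_cutoffProfile` with named scale and profile. [folklore] -/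
theorem lintegral_ball_curl_cutoffProfile'
    (hχ1 : ∀ x ∈ ball (0 : EuclideanSpace ℝ (Fin 3)) (1 / 2), ∀ᶠ z in 𝓝 x, χ z = 1)
    {tb : ℝ} (ht0 : tb < 0) {c : ℝ} (hc : c = Real.sqrt (-tb))
    {F : EuclideanSpace ℝ (Fin 3) → EuclideanSpace ℝ (Fin 3)}
    (hF : F = fun z => c • (χ (c • z) • u tb (c • z)))
    {R : ℝ} (hR : 0 < R) (hRc : 2 * R * c ≤ 1 / 2) :
    ∫⁻ y in ball (0 : EuclideanSpace ℝ (Fin 3)) (2 * R), ENNReal.ofReal (‖curl F y‖ ^ 2) =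
      ENNReal.ofReal c *
        ∫⁻ x in ball (0 : EuclideanSpace ℝ (Fin 3)) (2 * R * c), ENNReal.ofReal (‖curl (u tb) x‖ ^ 2) := by
  subst hF hc
  exact lintegral_ball_curl_cutoffProfile hχ1 ht0 hR hRc

/-- `divergence_cutoffProfile_eq_zero` with named scale and profile. [folklore] -/
theorem divergence_cutoffProfile_eq_zero'
    (hreg : IsClassicalNSSolutionOnRegion
      (Ico (-1 : ℝ) 0 ×ˢ ball (0 : EuclideanSpace ℝ (Fin 3)) 1) 1 0 u p)
    {tb : ℝ} (ht1 : -1 < tb) (ht0 : tb < 0) {c : ℝ} (hc : c = Real.sqrt (-tb))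
    {F : EuclideanSpace ℝ (Fin 3) → EuclideanSpace ℝ (Fin 3)}
    (hF : F = fun z => c • (χ (c • z) • u tb (c • z)))
    {y : EuclideanSpace ℝ (Fin 3)} (hy : c • y ∈ ball (0 : EuclideanSpace ℝ (Fin 3)) 1)
    (hχ1 : ∀ᶠ x in 𝓝 (c • y), χ x = 1) :
    VectorCalculus.divergence F y = 0 := by
  subst hF hc
  exact divergence_cutoffProfile_eq_zero hreg ht1 ht0 hy hχ1

end CutoffWrappers

section VorticitySmall

-- nested operator types and a long compactness argument
set_option maxSynthPendingDepth 3

set_option maxHeartbeats 3200000 in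
/-- **One-slice smallness of the vorticity at comparable scales** (the input (S4) of
`pineauVicol2026_oneSlice_regularity_of_core`): for a Type I classical solution on
`[-1,0) × B₁` whose pressure is bounded on the annulus `{½ < |x| < ¾}`, if the slice `t = t̄` is
`δ₀`-close to self-similar in the sense of (1.17) and `t̄` is close enough to `0`, then
`∫_{B(0, 2R√(−t̄))} |ω(t̄)|² ≤ θ²/(4√(−t̄))`.

Proof (replacing the principal-eigenfunction energy argument of Pineau–Vicol, §9.3 (9.20)–(9.22),
by compactness and Tsai's Liouville theorem, proved in the tree): if not, there are solutions
`(uₙ, pₙ)` and times `t̄ₙ → 0⁻` violating the bound with `δₙ → 0`; the cut-off similarity profiles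
`Fₙ(y) = cₙ (χuₙ(t̄ₙ))(cₙ y)`, `cₙ = √(−t̄ₙ)`, are bounded in `C³` on every ball by the quantitative
Serrin bounds (`exists_forall_iteratedFDeriv_le_of_typeI_of_bounds`), satisfy the profile system
up to the error `δₙ` (`cutoffProfile_eq`), are divergence free, obey `|Fₙ(y)| ≤ C_u/(1+|y|)`, and
have `∫_{B_{2R}} |curl Fₙ|² > θ²/4`. A `C²_loc` limit `G` (Arzelà–Ascoli,
`exists_subseq_tendstoUniformlyOn_of_bounds`) is then a Leray profile
(`IsLerayProfile 1 ½ G P`, the pressure recovered as a limit of gradients) in `L⁴(ℝ³)`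
(`memLp_four_of_profile_bound`), hence `G = 0` by Tsai's theorem (`tsai_selfsimilar_holds`),
contradicting `∫_{B_{2R}} |curl G|² ≥ θ²/4`. [cite: PineauVicol2026, §9.3, (9.20)–(9.23), arXiv:2607.09619 pp. 52–53; Tsai1998 Thm 1] -/
theorem pineauVicol_oneSlice_vorticity_small :
    ∀ Cu : ℝ, 0 < Cu → ∀ θ : ℝ, 0 < θ → ∀ R : ℝ, 2 ≤ R → ∃ δ₀ : ℝ, 0 < δ₀ ∧ δ₀ ≤ 1 ∧
      ∀ Cp : ℝ, 0 < Cp → ∃ s₁ : ℝ, 1 ≤ s₁ ∧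
      ∀ (u : ℝ → EuclideanSpace ℝ (Fin 3) → EuclideanSpace ℝ (Fin 3))
        (p : ℝ → EuclideanSpace ℝ (Fin 3) → ℝ),
        IsClassicalNSSolutionOnRegion
          (Ico (-1 : ℝ) 0 ×ˢ ball (0 : EuclideanSpace ℝ (Fin 3)) 1) 1 0 u p →
        (∀ t ∈ Ico (-1 : ℝ) 0, ∀ x ∈ ball (0 : EuclideanSpace ℝ (Fin 3)) 1,
          ‖u t x‖ ≤ Cu / (Real.sqrt (-t) + ‖x‖)) →
        (∀ t ∈ Ico (-1 : ℝ) 0, ∀ x : EuclideanSpace ℝ (Fin 3), 1 / 2 < ‖x‖ → ‖x‖ < 3 / 4 →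
          |p t x| ≤ Cp) →
        ∀ tb : ℝ, -Real.exp (-s₁) < tb → tb < 0 →
          (∀ x ∈ ball (0 : EuclideanSpace ℝ (Fin 3)) 1,
            ‖Real.sqrt (-tb) •
                ((-tb) • timeDerivOn (Ico (-1 : ℝ) 0 ×ˢ ball (0 : EuclideanSpace ℝ (Fin 3)) 1) u tb x
                  - (1 / 2 : ℝ) • u tb x - (1 / 2 : ℝ) • fderiv ℝ (u tb) x x)‖ ≤ δ₀) →
          ∫⁻ x in ball (0 : EuclideanSpace ℝ (Fin 3)) (2 * R * Real.sqrt (-tb)),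
              ENNReal.ofReal (‖curl (u tb) x‖ ^ 2) ≤
            ENNReal.ofReal (θ ^ 2 / (4 * Real.sqrt (-tb))) := by
  intro Cu hCu θ hθ R hR
  have hR0 : 0 < R := by linarith
  by_contra H
  push Not at H
  /- Step 0: uniform constants. -/
  choose K hK0 HK using fun k : ℕ => exists_forall_iteratedFDeriv_le_of_typeI_of_bounds k Cu
  set Bu : ℝ≥0∞ := ENNReal.ofReal (Cu ^ 3) *
    ((∫⁻ t in Ioo (-1 : ℝ) 0, ENNReal.ofReal ((-t) ^ (-(1 / 4 : ℝ)))) *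
      ∫⁻ x in ball (0 : EuclideanSpace ℝ (Fin 3)) 1, ENNReal.ofReal (‖x‖ ^ (-(5 / 2 : ℝ)))) with hBu_def
  have hBu : Bu < ⊤ := ENNReal.mul_lt_top ENNReal.ofReal_lt_top
    (ENNReal.mul_lt_top lintegral_Ioo_neg_rpow_quarter_lt_top lintegral_ball_norm_rpow_lt_top)
  /- Step 1: the contradicting sequence. -/
  have Hn : ∀ n : ℕ, ∃ Cp : ℝ, 0 < Cp ∧ ∀ s₁ : ℝ, 1 ≤ s₁ →
      ∃ (u : ℝ → EuclideanSpace ℝ (Fin 3) → EuclideanSpace ℝ (Fin 3))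
        (p : ℝ → EuclideanSpace ℝ (Fin 3) → ℝ),
        IsClassicalNSSolutionOnRegion
          (Ico (-1 : ℝ) 0 ×ˢ ball (0 : EuclideanSpace ℝ (Fin 3)) 1) 1 0 u p ∧
        (∀ t ∈ Ico (-1 : ℝ) 0, ∀ x ∈ ball (0 : EuclideanSpace ℝ (Fin 3)) 1,
          ‖u t x‖ ≤ Cu / (Real.sqrt (-t) + ‖x‖)) ∧
        (∀ t ∈ Ico (-1 : ℝ) 0, ∀ x : EuclideanSpace ℝ (Fin 3), 1 / 2 < ‖x‖ → ‖x‖ < 3 / 4 →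
          |p t x| ≤ Cp) ∧
        ∃ tb : ℝ, -Real.exp (-s₁) < tb ∧ tb < 0 ∧
          (∀ x ∈ ball (0 : EuclideanSpace ℝ (Fin 3)) 1,
            ‖Real.sqrt (-tb) •
                ((-tb) • timeDerivOn (Ico (-1 : ℝ) 0 ×ˢ ball (0 : EuclideanSpace ℝ (Fin 3)) 1) u tb x
                  - (1 / 2 : ℝ) • u tb x - (1 / 2 : ℝ) • fderiv ℝ (u tb) x x)‖ ≤ 1 / ((n : ℝ) + 2)) ∧
          ENNReal.ofReal (θ ^ 2 / (4 * Real.sqrt (-tb))) <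
            ∫⁻ x in ball (0 : EuclideanSpace ℝ (Fin 3)) (2 * R * Real.sqrt (-tb)),
              ENNReal.ofReal (‖curl (u tb) x‖ ^ 2) := fun n =>
    H (1 / ((n : ℝ) + 2)) (by positivity)
      (by rw [div_le_one (by positivity)]; linarith [(Nat.cast_nonneg n : (0 : ℝ) ≤ n)])
  choose Cp hCp H2 using Hn
  choose Bp hBp using fun n : ℕ => exists_lintegral_pressure_rpow_threeHalves_le Cu (Cp n)
  choose c₁ hc₁ Hd using fun (k : ℕ) (n : ℕ) => HK k Bu (Bp n) hBu ENNReal.coe_lt_top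
  -- the common radius of validity of the derivative bounds of orders `0, …, 3`
  obtain ⟨cmin, hcmin_def⟩ : ∃ cmin : ℕ → ℝ, ∀ n,
      cmin n = min (min (c₁ 0 n) (c₁ 1 n)) (min (c₁ 2 n) (c₁ 3 n)) := ⟨_, fun _ => rfl⟩
  have hcmin : ∀ n, 0 < cmin n := fun n => by
    rw [hcmin_def]; exact lt_min (lt_min (hc₁ 0 n) (hc₁ 1 n)) (lt_min (hc₁ 2 n) (hc₁ 3 n))
  have hcm0 : ∀ n, cmin n ≤ c₁ 0 n := fun n => by
    rw [hcmin_def]; exact (min_le_left _ _).trans (min_le_left _ _)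
  have hcm1 : ∀ n, cmin n ≤ c₁ 1 n := fun n => by
    rw [hcmin_def]; exact (min_le_left _ _).trans (min_le_right _ _)
  have hcm2 : ∀ n, cmin n ≤ c₁ 2 n := fun n => by
    rw [hcmin_def]; exact (min_le_right _ _).trans (min_le_left _ _)
  have hcm3 : ∀ n, cmin n ≤ c₁ 3 n := fun n => by
    rw [hcmin_def]; exact (min_le_right _ _).trans (min_le_right _ _)
  -- the size `Aₙ` the scale `cₙ = √(−t̄ₙ)` has to beat, and the corresponding `s₁`
  obtain ⟨A, hA_def⟩ : ∃ A : ℕ → ℝ, ∀ n,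
      A n = ((n : ℝ) + 2) / cmin n + 2 * ((n : ℝ) + 2) + 4 * R + 1 := ⟨_, fun _ => rfl⟩
  have hA : ∀ n, 0 < A n := fun n => by
    rw [hA_def]
    have := hcmin n
    positivity
  obtain ⟨S, hS_def⟩ : ∃ S : ℕ → ℝ, ∀ n, S n = max 1 (2 * A n) := ⟨_, fun _ => rfl⟩
  have hS1 : ∀ n, 1 ≤ S n := fun n => by rw [hS_def]; exact le_max_left _ _
  choose u p hreg hI hP tb htb1 htb0 hsl hbad using fun n => H2 n (S n) (hS1 n)
  /- Step 2: the scales `cₙ = √(−t̄ₙ)` are small. -/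
  obtain ⟨c, hcdef⟩ : ∃ c : ℕ → ℝ, ∀ n, c n = Real.sqrt (-tb n) := ⟨_, fun _ => rfl⟩
  have hc : ∀ n, 0 < c n := fun n => by rw [hcdef]; exact Real.sqrt_pos.2 (by linarith [htb0 n])
  have htb1' : ∀ n, -1 < tb n := fun n => by
    have h1 : Real.exp (-S n) ≤ 1 := Real.exp_le_one_iff.2 (by linarith [hS1 n])
    linarith [htb1 n]
  have hIoo : ∀ n, tb n ∈ Ioo (-1 : ℝ) 0 := fun n => ⟨htb1' n, htb0 n⟩
  have hcA : ∀ n, c n * A n < 1 := fun n => by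
    have h1 : -tb n < Real.exp (-S n) := by linarith [htb1 n]
    have h2 : c n < Real.exp (-(S n) / 2) := by
      rw [hcdef, show -(S n) / 2 = -S n / 2 by ring, Real.exp_half]
      exact Real.sqrt_lt_sqrt (by linarith [htb0 n]) h1
    have h3 : Real.exp (-(S n) / 2) ≤ Real.exp (-A n) :=
      Real.exp_le_exp.2 (by linarith [le_max_right 1 (2 * A n), hS_def n])
    have h4 : Real.exp (-A n) * A n < 1 := by
      have h5 : A n < Real.exp (A n) := by linarith [Real.add_one_le_exp (A n)]
      rw [Real.exp_neg]
      calc (Real.exp (A n))⁻¹ * A n < (Real.exp (A n))⁻¹ * Real.exp (A n) := by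
            gcongr
        _ = 1 := inv_mul_cancel₀ (Real.exp_pos _).ne'
    calc c n * A n ≤ Real.exp (-A n) * A n :=
          mul_le_mul_of_nonneg_right (h2.trans_le h3).le (hA n).le
      _ < 1 := h4
  -- consequences of the smallness of `cₙ`
  have hcn1 : ∀ n, c n * ((n : ℝ) + 2) ≤ cmin n := fun n => by
    have h1 : ((n : ℝ) + 2) / cmin n ≤ A n := by
      rw [hA_def]; linarith [hR0]
    have h2 : (n : ℝ) + 2 ≤ A n * cmin n := by
      rw [div_le_iff₀ (hcmin n)] at h1; linarith
    calc c n * ((n : ℝ) + 2) ≤ c n * (A n * cmin n) := by gcongr; exact (hc n).le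
      _ = (c n * A n) * cmin n := by ring
      _ ≤ 1 * cmin n := by gcongr; exacts [(hcmin n).le, (hcA n).le]
      _ = cmin n := one_mul _
  have hcn2 : ∀ n, c n * ((n : ℝ) + 2) < 1 / 2 := fun n => by
    have h1 : 2 * ((n : ℝ) + 2) < A n := by
      rw [hA_def]
      have := div_pos (by positivity : (0 : ℝ) < (n : ℝ) + 2) (hcmin n)
      linarith
    have h2 : c n * (2 * ((n : ℝ) + 2)) < c n * A n := by gcongr; exact hc n
    linarith [hcA n]
  have hcn3 : ∀ n, 2 * R * c n ≤ 1 / 2 := fun n => by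
    have h1 : 4 * R < A n := by
      rw [hA_def]
      have := div_pos (by positivity : (0 : ℝ) < (n : ℝ) + 2) (hcmin n)
      have : (0 : ℝ) ≤ n := Nat.cast_nonneg n
      linarith
    have h2 : c n * (4 * R) < c n * A n := by gcongr; exact hc n
    linarith [hcA n]
  /- Step 3: the cut-off and the profiles. -/
  let χb : ContDiffBump (0 : EuclideanSpace ℝ (Fin 3)) := ⟨1 / 2, 3 / 4, by norm_num, by norm_num⟩
  obtain ⟨χ, hχdef⟩ : ∃ χ : EuclideanSpace ℝ (Fin 3) → ℝ, χ = ⇑χb := ⟨_, rfl⟩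
  have hχ : ContDiff ℝ (⊤ : ℕ∞) χ := by rw [hχdef]; exact χb.contDiff
  have hχs : tsupport χ ⊆ ball (0 : EuclideanSpace ℝ (Fin 3)) 1 := by
    rw [hχdef, χb.tsupport_eq]
    exact closedBall_subset_ball (by norm_num)
  have hχ1 : ∀ x ∈ ball (0 : EuclideanSpace ℝ (Fin 3)) (1 / 2), ∀ᶠ z in 𝓝 x, χ z = 1 :=
    fun x hx => by
      have h := χb.eventuallyEq_one_of_mem_ball hx
      rw [hχdef]
      exact h.mono fun z hz => by simpa using hz
  have hχabs : ∀ x, |χ x| ≤ 1 := fun x => by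
    rw [hχdef]
    exact abs_le.2 ⟨by linarith [χb.nonneg (x := x)], χb.le_one⟩
  have hχ0 : ∀ x, x ∉ ball (0 : EuclideanSpace ℝ (Fin 3)) 1 → χ x = 0 := fun x hx =>
    image_eq_zero_of_notMem_tsupport fun h => hx (hχs h)
  have hsec : ∀ n, spaceSection (Ico (-1 : ℝ) 0 ×ˢ ball (0 : EuclideanSpace ℝ (Fin 3)) 1) (tb n) =
      ball 0 1 := fun n => spaceSection_prod (Ioo_subset_Ico_self (hIoo n)) _
  have hus : ∀ n, ContDiffOn ℝ (⊤ : ℕ∞) (u n (tb n)) (ball (0 : EuclideanSpace ℝ (Fin 3)) 1) :=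
    fun n => by have := (hreg n).contDiffOn_velocity (tb n); rwa [hsec n] at this
  have hps : ∀ n, ContDiffOn ℝ (⊤ : ℕ∞) (p n (tb n)) (ball (0 : EuclideanSpace ℝ (Fin 3)) 1) :=
    fun n => by have := (hreg n).contDiffOn_pressure (tb n); rwa [hsec n] at this
  obtain ⟨F, hFdef⟩ : ∃ F : ℕ → EuclideanSpace ℝ (Fin 3) → EuclideanSpace ℝ (Fin 3),
      ∀ n, F n = fun y => c n • (χ (c n • y) • u n (tb n) (c n • y)) := ⟨_, fun _ => rfl⟩
  obtain ⟨Qf, hQdef⟩ : ∃ Qf : ℕ → EuclideanSpace ℝ (Fin 3) → ℝ,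
      ∀ n, Qf n = fun y => c n ^ 2 * (χ (c n • y) * p n (tb n) (c n • y)) := ⟨_, fun _ => rfl⟩
  have hFs : ∀ n, ContDiff ℝ (⊤ : ℕ∞) (F n) := fun n => by
    rw [hFdef]
    exact ((contDiff_cutoff_smul_of_contDiffOn isOpen_ball hχ hχs (hus n)).comp
      (contDiff_id.const_smul (c n))).const_smul (c n)
  have hQs : ∀ n, ContDiff ℝ (⊤ : ℕ∞) (Qf n) := fun n => by
    rw [hQdef]
    exact ((contDiff_cutoff_smul_of_contDiffOn isOpen_ball hχ hχs (hps n)).comp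
      (contDiff_id.const_smul (c n))).const_smul (c n ^ 2)
  have hF3 : ∀ n, ContDiff ℝ 3 (F n) := fun n => contDiff_infty.1 (hFs n) 3
  have hQ1 : ∀ n, ContDiff ℝ 1 (Qf n) := fun n => contDiff_infty.1 (hQs n) 1
  have hQd : ∀ n, Differentiable ℝ (Qf n) := fun n => (hQ1 n).differentiable one_ne_zero
  -- where the bounds hold
  have hgood : ∀ m n : ℕ, m ≤ n → ∀ y ∈ closedBall (0 : EuclideanSpace ℝ (Fin 3)) ((m : ℝ) + 1),
      c n * (1 + ‖y‖) ≤ cmin n ∧ c n • y ∈ ball (0 : EuclideanSpace ℝ (Fin 3)) (1 / 2) ∧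
        c n • y ∈ ball (0 : EuclideanSpace ℝ (Fin 3)) 1 := by
    intro m n hmn y hy
    rw [mem_closedBall_zero_iff] at hy
    have hmn' : (m : ℝ) ≤ n := by exact_mod_cast hmn
    have h1 : c n * (1 + ‖y‖) ≤ c n * ((n : ℝ) + 2) :=
      mul_le_mul_of_nonneg_left (by linarith) (hc n).le
    have h2 : ‖c n • y‖ < 1 / 2 := by
      rw [norm_smul, Real.norm_of_nonneg (hc n).le]
      have : c n * ‖y‖ ≤ c n * ((n : ℝ) + 2) :=
        mul_le_mul_of_nonneg_left (by linarith [norm_nonneg y]) (hc n).le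
      linarith [hcn2 n]
    exact ⟨h1.trans (hcn1 n), mem_ball_zero_iff.2 h2, mem_ball_zero_iff.2 (by linarith)⟩
  -- the Type I bound of the profiles (everywhere)
  have hFI : ∀ n y, ‖F n y‖ ≤ Cu / (1 + ‖y‖) := by
    intro n y
    rw [hFdef]
    dsimp only
    by_cases hy : c n • y ∈ ball (0 : EuclideanSpace ℝ (Fin 3)) 1
    · have hIu := hI n (tb n) (Ioo_subset_Ico_self (hIoo n)) (c n • y) hy
      rw [← hcdef n, norm_smul, Real.norm_of_nonneg (hc n).le,
        show c n + c n * ‖y‖ = c n * (1 + ‖y‖) by ring] at hIu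
      have hpos : 0 < 1 + ‖y‖ := by positivity
      rw [norm_smul, norm_smul, Real.norm_of_nonneg (hc n).le, Real.norm_eq_abs]
      calc c n * (|χ (c n • y)| * ‖u n (tb n) (c n • y)‖)
          ≤ c n * (1 * (Cu / (c n * (1 + ‖y‖)))) :=
            mul_le_mul_of_nonneg_left
              (mul_le_mul (hχabs _) hIu (norm_nonneg _) zero_le_one) (hc n).le
        _ = Cu / (1 + ‖y‖) := by
            rw [one_mul, ← mul_div_assoc, mul_div_mul_left _ _ (hc n).ne']
    · rw [hχ0 _ hy, zero_smul, smul_zero, norm_zero]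
      positivity
  -- the `L³` bound of `uₙ` and the `L^{3/2}` bound of `pₙ`
  have hintU : ∀ n, ∫⁻ w in Ioo (-1 : ℝ) 0 ×ˢ ball (0 : EuclideanSpace ℝ (Fin 3)) 1,
      ‖u n w.1 w.2‖ₑ ^ (3 : ℕ) ≤ Bu := fun n => by
    calc ∫⁻ w in Ioo (-1 : ℝ) 0 ×ˢ ball (0 : EuclideanSpace ℝ (Fin 3)) 1, ‖u n w.1 w.2‖ₑ ^ (3 : ℕ)
        = ∫⁻ w in Ioo (-1 : ℝ) 0 ×ˢ ball (0 : EuclideanSpace ℝ (Fin 3)) 1,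
            ENNReal.ofReal (‖u n w.1 w.2‖ ^ 3) :=
          lintegral_congr fun w => by
            rw [← ofReal_norm, ← ENNReal.ofReal_pow (norm_nonneg _)]
      _ ≤ Bu := lintegral_typeI_cube_le (hI n)
  have hintP : ∀ n, ∫⁻ w in Ioo (-1 : ℝ) 0 ×ˢ ball (0 : EuclideanSpace ℝ (Fin 3)) (1 / 32),
      ‖p n w.1 w.2‖ₑ ^ (3 / 2 : ℝ) ≤ (Bp n : ℝ≥0∞) := fun n => hBp n (u n) (p n) (hreg n) (hI n) (hP n)
  -- the derivative bounds of orders `0, …, 3` on `B̄(0, m+1)` for `n ≥ m`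
  have hDk : ∀ k m n : ℕ, m ≤ n → cmin n ≤ c₁ k n →
      ∀ y ∈ closedBall (0 : EuclideanSpace ℝ (Fin 3)) ((m : ℝ) + 1),
        ‖iteratedFDeriv ℝ k (F n) y‖ ≤ K k := by
    intro k m n hmn hk y hy
    obtain ⟨hsm, hcy, hcy1⟩ := hgood m n hmn y hy
    have h := norm_iteratedFDeriv_cutoffProfile_le'
      (Hd k n (u n) (p n) (hreg n) (hI n) (hintU n) (hintP n)) (hreg n) hχ hχs (hIoo n) (hcdef n)
      (hFdef n) (hχ1 _ hcy) (hsm.trans hk)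
    refine h.trans (div_le_self (hK0 k) (one_le_pow₀ (by linarith [norm_nonneg y])))
  obtain ⟨Kmax, hKmax_def⟩ : ∃ Kmax : ℝ, Kmax = max (max (K 0) (K 1)) (max (K 2) (K 3)) := ⟨_, rfl⟩
  have hbB : ∀ m n : ℕ, m ≤ n → ∀ y ∈ closedBall (0 : EuclideanSpace ℝ (Fin 3)) ((m : ℝ) + 1),
      ‖F n y‖ ≤ Kmax ∧ ‖fderiv ℝ (F n) y‖ ≤ Kmax ∧ ‖fderiv ℝ (fderiv ℝ (F n)) y‖ ≤ Kmax ∧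
        ‖fderiv ℝ (fderiv ℝ (fderiv ℝ (F n))) y‖ ≤ Kmax := by
    intro m n hmn y hy
    refine ⟨?_, ?_, ?_, ?_⟩
    · rw [← norm_iteratedFDeriv_zero (𝕜 := ℝ) (f := F n)]
      exact (hDk 0 m n hmn (hcm0 n) y hy).trans
        (by rw [hKmax_def]; exact (le_max_left _ _).trans (le_max_left _ _))
    · rw [← norm_iteratedFDeriv_zero (𝕜 := ℝ) (f := fderiv ℝ (F n)), norm_iteratedFDeriv_fderiv]
      exact (hDk 1 m n hmn (hcm1 n) y hy).trans
        (by rw [hKmax_def]; exact (le_max_right _ _).trans (le_max_left _ _))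
    · rw [← norm_iteratedFDeriv_zero (𝕜 := ℝ) (f := fderiv ℝ (fderiv ℝ (F n))),
        norm_iteratedFDeriv_fderiv, norm_iteratedFDeriv_fderiv]
      exact (hDk 2 m n hmn (hcm2 n) y hy).trans
        (by rw [hKmax_def]; exact (le_max_left _ _).trans (le_max_right _ _))
    · rw [← norm_iteratedFDeriv_zero (𝕜 := ℝ) (f := fderiv ℝ (fderiv ℝ (fderiv ℝ (F n)))),
        norm_iteratedFDeriv_fderiv, norm_iteratedFDeriv_fderiv, norm_iteratedFDeriv_fderiv]
      exact (hDk 3 m n hmn (hcm3 n) y hy).trans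
        (by rw [hKmax_def]; exact (le_max_right _ _).trans (le_max_right _ _))
  /- Step 4: extraction of a `C²_loc` limit. -/
  obtain ⟨φ, hφ, G, G₁, G₂, hlim⟩ :=
    exists_subseq_tendstoUniformlyOn_of_bounds F hF3 fun m => ⟨m, Kmax, hbB m⟩
  obtain ⟨hGd, hG₁d, hG₂c, hG2⟩ :=
    hasFDerivAt_limits_of_tendstoUniformlyOn (fun n => F (φ n)) (fun n => hF3 (φ n)) hlim
  have hφle : ∀ n, n ≤ φ n := fun n => hφ.id_le n
  have hfG : fderiv ℝ G = G₁ := funext fun y => (hGd y).fderiv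
  have hfG₁ : fderiv ℝ G₁ = G₂ := funext fun y => (hG₁d y).fderiv
  have hGc : Continuous G := hG2.continuous
  have hG₁c : Continuous G₁ := continuous_iff_continuousAt.2 fun y => (hG₁d y).continuousAt
  have hmem : ∀ y : EuclideanSpace ℝ (Fin 3), ∃ m : ℕ,
      y ∈ closedBall (0 : EuclideanSpace ℝ (Fin 3)) ((m : ℝ) + 1) := fun y => by
    obtain ⟨m, hm⟩ := exists_nat_ge ‖y‖
    exact ⟨m, mem_closedBall_zero_iff.2 (by linarith)⟩
  -- Type I bound of the limit
  have hGI : ∀ y, ‖G y‖ ≤ Cu / (1 + ‖y‖) := fun y => by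
    obtain ⟨m, hy⟩ := hmem y
    exact le_of_tendsto ((hlim m).1.tendsto_at hy).norm (Eventually.of_forall fun n => hFI (φ n) y)
  -- bounds of the limits of the derivatives
  have hevB : ∀ m : ℕ, ∀ᶠ n in atTop, ∀ y ∈ closedBall (0 : EuclideanSpace ℝ (Fin 3)) ((m : ℝ) + 1),
      ‖F (φ n) y‖ ≤ Kmax ∧ ‖fderiv ℝ (F (φ n)) y‖ ≤ Kmax ∧
        ‖fderiv ℝ (fderiv ℝ (F (φ n))) y‖ ≤ Kmax ∧
        ‖fderiv ℝ (fderiv ℝ (fderiv ℝ (F (φ n)))) y‖ ≤ Kmax := fun m =>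
    (eventually_ge_atTop m).mono fun n hn y hy => hbB m (φ n) (hn.trans (hφle n)) y hy
  have hBG₁ : ∀ m : ℕ, ∀ y ∈ closedBall (0 : EuclideanSpace ℝ (Fin 3)) ((m : ℝ) + 1), ‖G₁ y‖ ≤ Kmax :=
    fun m => norm_le_of_tendstoUniformlyOn (hlim m).2.1 ((hevB m).mono fun n hn y hy => (hn y hy).2.1)
  /- Step 5: the limit is divergence free. -/
  have hdiv : ∀ y, VectorCalculus.divergence G y = 0 := fun y => by
    obtain ⟨m, hy⟩ := hmem y
    have ht : Tendsto (fun n => fderiv ℝ (F (φ n)) y) atTop (𝓝 (G₁ y)) := (hlim m).2.1.tendsto_at hy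
    have h1 := (continuous_trace_clm.tendsto _).comp ht
    have h0 : ∀ᶠ n in atTop, LinearMap.trace ℝ (EuclideanSpace ℝ (Fin 3))
        (fderiv ℝ (F (φ n)) y : EuclideanSpace ℝ (Fin 3) →ₗ[ℝ] EuclideanSpace ℝ (Fin 3)) = 0 :=
      (eventually_ge_atTop m).mono fun n hn => by
        obtain ⟨-, hcy, hcy1⟩ := hgood m (φ n) (hn.trans (hφle n)) y hy
        exact divergence_cutoffProfile_eq_zero' (hreg (φ n)) (htb1' (φ n)) (htb0 (φ n))
          (hcdef (φ n)) (hFdef (φ n)) hcy1 (hχ1 _ hcy)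
    have h2 : Tendsto (fun n => LinearMap.trace ℝ (EuclideanSpace ℝ (Fin 3))
        (fderiv ℝ (F (φ n)) y : EuclideanSpace ℝ (Fin 3) →ₗ[ℝ] EuclideanSpace ℝ (Fin 3)))
        atTop (𝓝 0) :=
      tendsto_const_nhds.congr' (h0.mono fun n hn => hn.symm)
    unfold VectorCalculus.divergence
    rw [hfG]
    exact tendsto_nhds_unique h1 h2
  /- Step 6: the profile equation in the limit. -/
  obtain ⟨Er, hEr⟩ : ∃ Er : ℕ → EuclideanSpace ℝ (Fin 3) → EuclideanSpace ℝ (Fin 3), ∀ n y,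
      Er n y = -(c n • ((-tb n) •
        timeDerivOn (Ico (-1 : ℝ) 0 ×ˢ ball (0 : EuclideanSpace ℝ (Fin 3)) 1) (u n) (tb n) (c n • y)
          - (1 / 2 : ℝ) • u n (tb n) (c n • y)
          - (1 / 2 : ℝ) • fderiv ℝ (u n (tb n)) (c n • y) (c n • y))) := ⟨_, fun _ _ => rfl⟩
  have hEr_le : ∀ m n : ℕ, m ≤ n → ∀ y ∈ closedBall (0 : EuclideanSpace ℝ (Fin 3)) ((m : ℝ) + 1),
      ‖Er n y‖ ≤ 1 / ((n : ℝ) + 2) := by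
    intro m n hmn y hy
    obtain ⟨-, -, hcy1⟩ := hgood m n hmn y hy
    have h := hsl n (c n • y) hcy1
    rw [← hcdef n] at h
    rw [hEr, norm_neg]
    exact h
  -- the standard basis and the Laplacians
  set e : Fin 3 → EuclideanSpace ℝ (Fin 3) := fun i => EuclideanSpace.basisFun (Fin 3) ℝ i with he
  have hLapF : ∀ n y, (Δ (F n)) y = ∑ i, fderiv ℝ (fderiv ℝ (F n)) y (e i) (e i) := fun n y =>
    laplacian_apply_eq_sum_fderiv_fderiv_basisFun _ _
  have hLapG : ∀ y, (Δ G) y = ∑ i, G₂ y (e i) (e i) := fun y => by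
    rw [laplacian_apply_eq_sum_fderiv_fderiv_basisFun, hfG, hfG₁]
  -- the pressure gradient of the cut-off profiles in terms of the converging quantities
  have hWeq : ∀ m n : ℕ, m ≤ n → ∀ y ∈ closedBall (0 : EuclideanSpace ℝ (Fin 3)) ((m : ℝ) + 1),
      gradient (Qf n) y = Er n y + (∑ i, fderiv ℝ (fderiv ℝ (F n)) y (e i) (e i))
        - (1 / 2 : ℝ) • F n y - (1 / 2 : ℝ) • fderiv ℝ (F n) y y - fderiv ℝ (F n) y (F n y) := by
    intro m n hmn y hy
    obtain ⟨-, hcy, hcy1⟩ := hgood m n hmn y hy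
    have h := cutoffProfile_eq' (hreg n) (htb1' n) (htb0 n) (hcdef n) (hFdef n) (hQdef n) hcy1
      (hχ1 _ hcy)
    rw [hLapF n y, ← hEr n y] at h
    unfold convect at h
    refine sub_eq_zero.1 ?_
    have h2 := sub_eq_zero.2 h
    calc gradient (Qf n) y - (Er n y + (∑ i, fderiv ℝ (fderiv ℝ (F n)) y (e i) (e i))
          - (1 / 2 : ℝ) • F n y - (1 / 2 : ℝ) • fderiv ℝ (F n) y y - fderiv ℝ (F n) y (F n y))
        = -(∑ i, fderiv ℝ (fderiv ℝ (F n)) y (e i) (e i)) + (1 / 2 : ℝ) • F n y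
            + (1 / 2 : ℝ) • fderiv ℝ (F n) y y + fderiv ℝ (F n) y (F n y) + gradient (Qf n) y
            - Er n y := by abel
      _ = 0 := h2
  -- the limit `W'` of the pressure gradients
  obtain ⟨W', hW'def⟩ : ∃ W' : EuclideanSpace ℝ (Fin 3) → EuclideanSpace ℝ (Fin 3), ∀ y,
      W' y = (∑ i, G₂ y (e i) (e i)) - (1 / 2 : ℝ) • G y - (1 / 2 : ℝ) • G₁ y y - G₁ y (G y) :=
    ⟨_, fun _ => rfl⟩
  have hW'c : Continuous W' := by
    have e1 : W' = fun y => (∑ i, G₂ y (e i) (e i)) - (1 / 2 : ℝ) • G y - (1 / 2 : ℝ) • G₁ y y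
        - G₁ y (G y) := funext hW'def
    rw [e1]
    have hs : Continuous fun y => ∑ i, G₂ y (e i) (e i) :=
      continuous_finsetSum _ fun i _ => (hG₂c.clm_apply continuous_const).clm_apply continuous_const
    have c1 : Continuous fun y => (1 / 2 : ℝ) • G y := hGc.const_smul (1 / 2 : ℝ)
    have c2 : Continuous fun y => (1 / 2 : ℝ) • G₁ y y :=
      (hG₁c.clm_apply continuous_id).const_smul (1 / 2 : ℝ)
    have c3 : Continuous fun y => G₁ y (G y) := hG₁c.clm_apply hGc
    exact ((hs.sub c1).sub c2).sub c3
  have hWφ : ∀ m : ℕ, TendstoUniformlyOn (fun n y => gradient (Qf (φ n)) y) W' atTop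
      (closedBall (0 : EuclideanSpace ℝ (Fin 3)) ((m : ℝ) + 1)) := by
    intro m
    set s : Set (EuclideanSpace ℝ (Fin 3)) := closedBall 0 ((m : ℝ) + 1) with hs_def
    have hT0 : TendstoUniformlyOn (fun n => F (φ n)) G atTop s := (hlim m).1
    have hT1g : TendstoUniformlyOn (fun n => fderiv ℝ (F (φ n))) G₁ atTop s := (hlim m).2.1
    have hT2g : TendstoUniformlyOn (fun n => fderiv ℝ (fderiv ℝ (F (φ n)))) G₂ atTop s :=
      (hlim m).2.2
    -- the error tends to zero uniformly
    have hE : TendstoUniformlyOn (fun n y => Er (φ n) y) (fun _ => (0 : EuclideanSpace ℝ (Fin 3)))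
        atTop s := by
      rw [Metric.tendstoUniformlyOn_iff]
      intro ε hε
      obtain ⟨N, hN⟩ := exists_nat_gt (1 / ε)
      filter_upwards [eventually_ge_atTop (max N m)] with n hn y hy
      have hnm : m ≤ n := (le_max_right _ _).trans hn
      have hnN : N ≤ n := (le_max_left _ _).trans hn
      rw [dist_comm, dist_zero_right]
      refine (hEr_le m (φ n) (hnm.trans (hφle n)) y hy).trans_lt ?_
      have h1 : (N : ℝ) ≤ φ n := by exact_mod_cast hnN.trans (hφle n)
      have h2 : 1 / ε < (φ n : ℝ) + 2 := by linarith
      rw [one_div_lt hε (by positivity)] at h2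
      exact h2
    -- the Laplacians converge uniformly
    have hLap : TendstoUniformlyOn (fun n y => ∑ i, fderiv ℝ (fderiv ℝ (F (φ n))) y (e i) (e i))
        (fun y => ∑ i, G₂ y (e i) (e i)) atTop s := by
      have hi : ∀ i, TendstoUniformlyOn (fun n y => fderiv ℝ (fderiv ℝ (F (φ n))) y (e i) (e i))
          (fun y => G₂ y (e i) (e i)) atTop s := fun i =>
        tendstoUniformlyOn_clm_apply_const (tendstoUniformlyOn_clm_apply_const hT2g (e i)) (e i)
      simp only [Fin.sum_univ_three]
      exact ((hi 0).add (hi 1)).add (hi 2)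
    -- `DFₙ(y)[y]` and `DFₙ(y)[Fₙ(y)]`
    have hT1 : TendstoUniformlyOn (fun n y => fderiv ℝ (F (φ n)) y y) (fun y => G₁ y y) atTop s :=
      tendstoUniformlyOn_clm_apply_of_bound hT1g
        (tendstoUniformlyOn_const_seq (fun y : EuclideanSpace ℝ (Fin 3) => y) s)
        (B₁ := (m : ℝ) + 1) (Eventually.of_forall fun n y hy => mem_closedBall_zero_iff.1 hy)
        (hBG₁ m)
    have hT2 : TendstoUniformlyOn (fun n y => fderiv ℝ (F (φ n)) y (F (φ n) y))
        (fun y => G₁ y (G y)) atTop s :=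
      tendstoUniformlyOn_clm_apply_of_bound hT1g hT0 (B₁ := Cu)
        (Eventually.of_forall fun n y _ =>
          (hFI (φ n) y).trans (div_le_self hCu.le (by linarith [norm_nonneg y])))
        (hBG₁ m)
    have hH0 : TendstoUniformlyOn (fun n y => (1 / 2 : ℝ) • F (φ n) y)
        (fun y => (1 / 2 : ℝ) • G y) atTop s :=
      (uniformContinuous_const_smul (1 / 2 : ℝ)).comp_tendstoUniformlyOn hT0
    have hH1 : TendstoUniformlyOn (fun n y => (1 / 2 : ℝ) • fderiv ℝ (F (φ n)) y y)
        (fun y => (1 / 2 : ℝ) • G₁ y y) atTop s :=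
      (uniformContinuous_const_smul (1 / 2 : ℝ)).comp_tendstoUniformlyOn hT1
    have hX : TendstoUniformlyOn
        (fun n y => Er (φ n) y + (∑ i, fderiv ℝ (fderiv ℝ (F (φ n))) y (e i) (e i))
          - (1 / 2 : ℝ) • F (φ n) y - (1 / 2 : ℝ) • fderiv ℝ (F (φ n)) y y
          - fderiv ℝ (F (φ n)) y (F (φ n) y))
        (fun y => 0 + (∑ i, G₂ y (e i) (e i)) - (1 / 2 : ℝ) • G y - (1 / 2 : ℝ) • G₁ y y
          - G₁ y (G y)) atTop s :=
      (((hE.add hLap).sub hH0).sub hH1).sub hT2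
    refine (hX.congr ?_).congr_right ?_
    · filter_upwards [eventually_ge_atTop m] with n hn y hy
      exact (hWeq m (φ n) (hn.trans (hφle n)) y hy).symm
    · intro y _
      dsimp only
      rw [hW'def, zero_add]
  obtain ⟨P, hPg⟩ := exists_hasGradientAt_of_tendstoUniformlyOn
    (Q := fun n => Qf (φ n)) (W := fun n y => gradient (Qf (φ n)) y)
    (fun n y => ((hQd (φ n)) y).hasGradientAt) hWφ
  /- Step 7: the limit is a Leray profile in `L⁴`, hence zero. -/
  have hprof : IsLerayProfile 1 (1 / 2) G P :=
    { contDiff_velocity := hG2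
      contDiff_pressure := contDiff_one_of_hasGradientAt hPg hW'c
      profile_eq := fun y => by
        rw [one_smul, hLapG y, (hPg y).gradient, hW'def]
        simp only [convect, hfG]
        abel
      divFree := hdiv }
  have hL4 : MemLp G 4 volume :=
    memLp_four_of_profile_bound hGc (C₀ := Cu) fun y => by rw [add_comm]; exact hGI y
  have hT := @tsai_selfsimilar_holds
  have hG0 : G = 0 :=
    hT (ν := 1) (a := 1 / 2) one_pos (by norm_num) hprof (q := 4) (by norm_num) (by simp) hL4
  /- Step 8: contradiction with the largeness of the vorticity. -/
  have hG₁0 : ∀ y, G₁ y = 0 := fun y => by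
    have h0 : (0 : EuclideanSpace ℝ (Fin 3) → EuclideanSpace ℝ (Fin 3)) =
        fun _ => (0 : EuclideanSpace ℝ (Fin 3)) := rfl
    rw [← hfG, hG0, h0, fderiv_const_apply]
  set M : ℕ := ⌈2 * R⌉₊ with hM
  have hMR : 2 * R ≤ (M : ℝ) := by rw [hM]; exact Nat.le_ceil _
  have hballM : ball (0 : EuclideanSpace ℝ (Fin 3)) (2 * R) ⊆ closedBall 0 ((M : ℝ) + 1) := by
    intro y hy
    rw [mem_ball_zero_iff] at hy
    exact mem_closedBall_zero_iff.2 (by linarith)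
  -- the volume of `B(0, 2R)` and the size of the curl map
  set κ : ℝ := ‖curlCLM‖ with hκ
  set v : ℝ := (volume (ball (0 : EuclideanSpace ℝ (Fin 3)) (2 * R))).toReal with hv
  have hvfin : volume (ball (0 : EuclideanSpace ℝ (Fin 3)) (2 * R)) < ⊤ := measure_ball_lt_top
  have hv0 : 0 ≤ v := ENNReal.toReal_nonneg
  have hκ0 : 0 ≤ κ := norm_nonneg _
  set η : ℝ := min 1 (θ ^ 2 / (4 * ((κ ^ 2 + 1) * (v + 1)))) with hη
  have hη0 : 0 < η := lt_min one_pos (by positivity)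
  have hη1 : η ≤ 1 := min_le_left _ _
  have hη2 : η ≤ θ ^ 2 / (4 * ((κ ^ 2 + 1) * (v + 1))) := min_le_right _ _
  have hkey : κ ^ 2 * η ^ 2 * v ≤ θ ^ 2 / 4 := by
    have h1 : κ ^ 2 * v ≤ (κ ^ 2 + 1) * (v + 1) := by nlinarith
    calc κ ^ 2 * η ^ 2 * v = (κ ^ 2 * v * η) * η := by ring
      _ ≤ (κ ^ 2 * v * η) * 1 := mul_le_mul_of_nonneg_left hη1 (by positivity)
      _ ≤ ((κ ^ 2 + 1) * (v + 1)) * η := by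
          rw [mul_one]; exact mul_le_mul_of_nonneg_right h1 hη0.le
      _ ≤ ((κ ^ 2 + 1) * (v + 1)) * (θ ^ 2 / (4 * ((κ ^ 2 + 1) * (v + 1)))) := by gcongr
      _ = θ ^ 2 / 4 := by field_simp
  -- eventually the gradients are `η`-small on `B̄(0, M+1)`
  have hsmall : ∀ᶠ n in atTop, ∀ y ∈ closedBall (0 : EuclideanSpace ℝ (Fin 3)) ((M : ℝ) + 1),
      ‖fderiv ℝ (F (φ n)) y‖ < η := by
    have h := (Metric.tendstoUniformlyOn_iff.1 (hlim M).2.1) η hη0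
    filter_upwards [h] with n hn y hy
    have := hn y hy
    rwa [hG₁0 y, dist_comm, dist_zero_right] at this
  obtain ⟨n, hn⟩ := hsmall.exists
  -- lower bound: the largeness of the vorticity in similarity variables
  have hlow : ENNReal.ofReal (θ ^ 2 / 4) <
      ∫⁻ y in ball (0 : EuclideanSpace ℝ (Fin 3)) (2 * R), ENNReal.ofReal (‖curl (F (φ n)) y‖ ^ 2) := by
    have hb := hbad (φ n)
    rw [← hcdef (φ n)] at hb
    rw [lintegral_ball_curl_cutoffProfile' hχ1 (htb0 (φ n)) (hcdef (φ n)) (hFdef (φ n)) hR0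
      (hcn3 (φ n))]
    have hc0 : ENNReal.ofReal (c (φ n)) ≠ 0 := (ENNReal.ofReal_pos.2 (hc (φ n))).ne'
    have hcne : c (φ n) ≠ 0 := (hc (φ n)).ne'
    calc ENNReal.ofReal (θ ^ 2 / 4)
        = ENNReal.ofReal (c (φ n)) * ENNReal.ofReal (θ ^ 2 / (4 * c (φ n))) := by
          rw [← ENNReal.ofReal_mul (hc (φ n)).le, ← mul_div_assoc, mul_comm (c (φ n)) (θ ^ 2),
            mul_div_mul_right _ _ hcne]
      _ < ENNReal.ofReal (c (φ n)) *
          ∫⁻ x in ball (0 : EuclideanSpace ℝ (Fin 3)) (2 * R * c (φ n)),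
            ENNReal.ofReal (‖curl (u (φ n) (tb (φ n))) x‖ ^ 2) :=
          ENNReal.mul_lt_mul_right hc0 ENNReal.ofReal_ne_top hb
  -- upper bound: the gradients, hence the curls, are small
  have hup : ∫⁻ y in ball (0 : EuclideanSpace ℝ (Fin 3)) (2 * R), ENNReal.ofReal (‖curl (F (φ n)) y‖ ^ 2) ≤
      ENNReal.ofReal (θ ^ 2 / 4) := by
    calc ∫⁻ y in ball (0 : EuclideanSpace ℝ (Fin 3)) (2 * R), ENNReal.ofReal (‖curl (F (φ n)) y‖ ^ 2)
        ≤ ∫⁻ y in ball (0 : EuclideanSpace ℝ (Fin 3)) (2 * R), ENNReal.ofReal (κ ^ 2 * η ^ 2) := by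
          refine setLIntegral_mono' measurableSet_ball fun y hy => ENNReal.ofReal_le_ofReal ?_
          have h1 : ‖curl (F (φ n)) y‖ ≤ κ * η :=
            (norm_curl_le _ _).trans (mul_le_mul_of_nonneg_left (hn y (hballM hy)).le hκ0)
          calc ‖curl (F (φ n)) y‖ ^ 2 ≤ (κ * η) ^ 2 := pow_le_pow_left₀ (norm_nonneg _) h1 2
            _ = κ ^ 2 * η ^ 2 := by ring
      _ = ENNReal.ofReal (κ ^ 2 * η ^ 2) * volume (ball (0 : EuclideanSpace ℝ (Fin 3)) (2 * R)) :=
          setLIntegral_const _ _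
      _ = ENNReal.ofReal (κ ^ 2 * η ^ 2 * v) := by
          rw [hv, ENNReal.ofReal_mul (p := κ ^ 2 * η ^ 2) (by positivity),
            ENNReal.ofReal_toReal hvfin.ne]
      _ ≤ ENNReal.ofReal (θ ^ 2 / 4) := ENNReal.ofReal_le_ofReal hkey
  exact lt_irrefl _ (hlow.trans_le hup)

end VorticitySmall

end Literature.Analysis.FluidPDE

end
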